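import Literature.MathematicalPhysics.QuantumLattice.LiebWuIntegralEquations
import Literature.MathematicalPhysics.QuantumLattice.LiebWuHalfFilledDensities
import HarnessLib

/-!
# The closed forms (18)–(20) are the `B = ∞`, `Q = π` solution of the Lieb–Wu equations (13)–(17)

Family `hubbard`. Assembly of `LiebWuIntegralEquations` (the printed equations (13)–(17) at general
filling, `IsLiebWuDensities`) and `LiebWuHalfFilledDensities` (the printed closed forms
`ρ₀` (19), `σ₀` (18) satisfy the kernel form of (13)–(14) at `Q = π`, `B = ∞`, `∫σ₀ = ½`):
Lieb–Wu, PRL 20 (1968) 1445, reprint p. 67, L23: "For `B = ∞` and `Q = π`, (13)–(16) can be solved in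
closed form by Fourier transforms with the result (18)–(20)." PROVED here as
* `isLiebWuDensities_pi_liebWuRho0_liebWuSigma0`: `IsLiebWuDensities U π univ ρ₀ σ₀` (`U > 0`);
* `liebWuDownSpinDensity_univ_liebWuSigma0`: (16) `M/N_a = ½` (statement (b): `S_z = 0`);
* `isLiebWuEnergyAt_one_liebWuEnergy`: `liebWuEnergy U` (eq. (20)) IS a Lieb–Wu ground-state energy
  per site at filling `1` in the sense of `IsLiebWuEnergyAt` — the non-vacuity of that predicate;
together with the constructor `IsLiebWuDensities.of_kernel_form` (the Physica A 321 (2003) §4 boxed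
form of (13)–(14) implies the printed PRL form). No new definition, no named fact.

## References

* E. H. Lieb, F. Y. Wu, Phys. Rev. Lett. 20 (1968) 1445, eqs. (13)–(20), statements (a)–(c)
  (key `LiebWuPRL1968`; reprint A. Montorsi (ed.), The Hubbard Model, World Scientific, p. 67).
* E. H. Lieb, F. Y. Wu, Physica A 321 (2003) 1 = arXiv:cond-mat/0207529, §4, §6 (key `LiebWuPhysicaA2003`).
-/

noncomputable section

open MeasureTheory Set Real intervalIntegral
open Literature.Analysis.SpecialFunctions Literature.Analysis.FunctionSpaces

namespace Literature.MathematicalPhysics.QuantumLattice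

/-! ### The printed kernels inside the integrals of (13)–(14) -/

/-- The `Λ`-integral of (13) in kernel form: `∫_S 8Uσ(Λ)/(U² + 16(a - Λ)²) dΛ = 2π ∫_S K_{U/4}(a - Λ)σ(Λ) dΛ`.
[cite: LiebWuPhysicaA2003, §4, kernel K] -/
theorem setIntegral_liebWu_kernel13_mul (U a : ℝ) (S : Set ℝ) (σ : ℝ → ℝ) :
    ∫ Λ in S, 8 * U * σ Λ / (U ^ 2 + 16 * (a - Λ) ^ 2) =
      2 * π * ∫ Λ in S, cauchyDensity (U / 4) (a - Λ) * σ Λ := by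
  rw [← MeasureTheory.integral_const_mul]
  refine integral_congr_ae (Filter.Eventually.of_forall fun Λ => ?_)
  have := liebWu_kernel13_eq U (a - Λ)
  calc 8 * U * σ Λ / (U ^ 2 + 16 * (a - Λ) ^ 2)
      = 8 * U / (U ^ 2 + 16 * (a - Λ) ^ 2) * σ Λ := by ring
    _ = 2 * π * (cauchyDensity (U / 4) (a - Λ) * σ Λ) := by rw [this]; ring

/-- The `k`-integral of (14) in kernel form:
`∫_{-Q}^{Q} 8Uρ(k)/(U² + 16(Λ - sin k)²) dk = 2π ∫_{-Q}^{Q} K_{U/4}(Λ - sin k)ρ(k) dk`.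
[cite: LiebWuPhysicaA2003, §4, kernel K] -/
theorem intervalIntegral_liebWu_kernel13_mul (U Λ Q : ℝ) (ρ : ℝ → ℝ) :
    ∫ k in -Q..Q, 8 * U * ρ k / (U ^ 2 + 16 * (Λ - Real.sin k) ^ 2) =
      2 * π * ∫ k in -Q..Q, cauchyDensity (U / 4) (Λ - Real.sin k) * ρ k := by
  rw [← intervalIntegral.integral_const_mul]
  refine intervalIntegral.integral_congr fun k _ => ?_
  have := liebWu_kernel13_eq U (Λ - Real.sin k)
  calc 8 * U * ρ k / (U ^ 2 + 16 * (Λ - Real.sin k) ^ 2)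
      = 8 * U / (U ^ 2 + 16 * (Λ - Real.sin k) ^ 2) * ρ k := by ring
    _ = 2 * π * (cauchyDensity (U / 4) (Λ - Real.sin k) * ρ k) := by rw [this]; ring

/-- The `Λ'`-integral of (14) in kernel form:
`∫_S 4Uσ(Λ')/(U² + 4(Λ - Λ')²) dΛ' = 2π ∫_S K_{U/2}(Λ - Λ')σ(Λ') dΛ'`. [cite: LiebWuPhysicaA2003, §4, kernel K²] -/
theorem setIntegral_liebWu_kernel14_mul (U Λ : ℝ) (S : Set ℝ) (σ : ℝ → ℝ) :
    ∫ Λ' in S, 4 * U * σ Λ' / (U ^ 2 + 4 * (Λ - Λ') ^ 2) =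
      2 * π * ∫ Λ' in S, cauchyDensity (U / 2) (Λ - Λ') * σ Λ' := by
  rw [← MeasureTheory.integral_const_mul]
  refine integral_congr_ae (Filter.Eventually.of_forall fun Λ' => ?_)
  have := liebWu_kernel14_eq U (Λ - Λ')
  calc 4 * U * σ Λ' / (U ^ 2 + 4 * (Λ - Λ') ^ 2)
      = 4 * U / (U ^ 2 + 4 * (Λ - Λ') ^ 2) * σ Λ' := by ring
    _ = 2 * π * (cauchyDensity (U / 2) (Λ - Λ') * σ Λ') := by rw [this]; ring

/-- **Constructor from the kernel form.** If `(ρ, σ) ∈ L¹([-Q, Q]) × L¹(SΛ)` satisfy the boxed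
equations of Lieb–Wu 2003, §4 — `ρ(k) = 1/2π + cos k ∫_{SΛ} K_{U/4}(sin k - Λ)σ(Λ) dΛ` on `[-Q, Q]` and
`σ(Λ) = ∫_{-Q}^{Q} K_{U/4}(Λ - sin k)ρ(k) dk - ∫_{SΛ} K_{U/2}(Λ - Λ')σ(Λ') dΛ'` on `SΛ` — then they
satisfy the printed PRL equations (13)–(14). [cite: LiebWuPhysicaA2003, §4, boxed equations for ρ and σ] -/
theorem IsLiebWuDensities.of_kernel_form {U Q : ℝ} {SΛ : Set ℝ} {ρ σ : ℝ → ℝ}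
    (hQ : 0 < Q) (hQπ : Q ≤ π) (hS : (∃ B : ℝ, 0 < B ∧ SΛ = Icc (-B) B) ∨ SΛ = univ)
    (hρ : IntervalIntegrable ρ volume (-Q) Q) (hσ : IntegrableOn σ SΛ)
    (h13 : ∀ k ∈ Icc (-Q) Q,
      ρ k = 1 / (2 * π) + Real.cos k * ∫ Λ in SΛ, cauchyDensity (U / 4) (Real.sin k - Λ) * σ Λ)
    (h14 : ∀ Λ ∈ SΛ, σ Λ = (∫ k in -Q..Q, cauchyDensity (U / 4) (Λ - Real.sin k) * ρ k) -
      ∫ Λ' in SΛ, cauchyDensity (U / 2) (Λ - Λ') * σ Λ') :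
    IsLiebWuDensities U Q SΛ ρ σ where
  cutoff_pos := hQ
  cutoff_le_pi := hQπ
  range_eq := hS
  intervalIntegrable_rho := hρ
  integrableOn_sigma := hσ
  two_pi_mul_rho_eq k hk := by
    rw [setIntegral_liebWu_kernel13_mul, h13 k hk]
    have hπ : π ≠ 0 := Real.pi_pos.ne'
    field_simp
  integral_rho_eq Λ hΛ := by
    rw [intervalIntegral_liebWu_kernel13_mul, setIntegral_liebWu_kernel14_mul, h14 Λ hΛ]
    ring

/-! ### The half-filled instance -/

/-- **(18)–(19) solve (13)–(14) at `Q = π`, `B = ∞`** ("For `B = ∞` and `Q = π`, (13)–(16) can be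
solved in closed form by Fourier transforms with the result (18)–(20)"): for `U > 0` the pair
`(ρ₀, σ₀) = (liebWuRho0 U, liebWuSigma0 U)` is an `L¹` solution of the Lieb–Wu equations with momentum
cutoff `π` and rapidity range `ℝ`. [cite: LiebWuPRL1968, eqs. (13)–(14), (18)–(19)] -/
theorem isLiebWuDensities_pi_liebWuRho0_liebWuSigma0 {U : ℝ} (hU : 0 < U) :
    IsLiebWuDensities U π univ (liebWuRho0 U) (liebWuSigma0 U) := by
  refine IsLiebWuDensities.of_kernel_form Real.pi_pos le_rfl (Or.inr rfl)
    ((continuous_liebWuRho0 hU).intervalIntegrable _ _) (integrable_liebWuSigma0 hU).integrableOn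
    (fun k _ => ?_) (fun Λ _ => ?_)
  · rw [Measure.restrict_univ]
    exact liebWuRho0_eq_integral_sigma0 hU k
  · rw [Measure.restrict_univ]
    exact liebWuSigma0_eq_integral_rho0_sub hU Λ

/-- The half-filled closed forms are absolute-ground-state densities (`B = ∞`, statement (b)).
[cite: LiebWuPRL1968, statement (b)] -/
theorem isLiebWuGroundStateDensities_pi_liebWuRho0_liebWuSigma0 {U : ℝ} (hU : 0 < U) :
    IsLiebWuGroundStateDensities U π (liebWuRho0 U) (liebWuSigma0 U) :=
  isLiebWuDensities_pi_liebWuRho0_liebWuSigma0 hU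

/-- **Eq. (16) at `B = ∞`, `Q = π`: `M/N_a = ½`** (`S_z = 0`, "the antiferromagnetic case").
[cite: LiebWuPRL1968, eq. (16) and statement (b)] -/
theorem liebWuDownSpinDensity_univ_liebWuSigma0 {U : ℝ} (hU : 0 < U) :
    liebWuDownSpinDensity univ (liebWuSigma0 U) = 1 / 2 := by
  rw [liebWuDownSpinDensity_univ, integral_liebWuSigma0 hU]

/-- **`liebWuEnergy U` (eq. (20)) is the Lieb–Wu ground-state energy per site at filling `N/N_a = 1`**
in the sense of `IsLiebWuEnergyAt`: witnessed by `Q = π`, `(ρ₀, σ₀)`, with (15) `∫_{-π}^{π} ρ₀ = 1`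
and (17) `-2∫_{-π}^{π} ρ₀ cos = liebWuEnergy U`. [cite: LiebWuPRL1968, eqs. (15), (17), (20)] -/
theorem isLiebWuEnergyAt_one_liebWuEnergy {U : ℝ} (hU : 0 < U) :
    IsLiebWuEnergyAt U 1 (liebWuEnergy U) :=
  ⟨π, liebWuRho0 U, liebWuSigma0 U, isLiebWuDensities_pi_liebWuRho0_liebWuSigma0 hU,
    liebWuFilling_pi_liebWuRho0 hU, liebWuEnergyPerSite_pi_liebWuRho0 hU⟩

end Literature.MathematicalPhysics.QuantumLattice

end
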